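import Summits.Ventures.HSemireg.WedgeHankelRankOne
import Summits.Ventures.HSemireg.WedgeHankelFrameChange
import Summits.Ventures.HSemireg.WedgeHankelConfluentPoint

/-!
# Venture HSemireg — THE SWAP `x_a ↔ y_a`: an algebra automorphism of th-7's model carrying `w_m(q)` to `w_m(q reversed)`, the Siegel ideal to itself
# and `plane(a,b)` to `plane(b,a)` — the node `∞` IS a node: every `x`-statement of the lineage has its `y`-mirror for free

HONEST FRAMING. Part of the Lean index of the computation cell `pub-hsemireg` (seat p10 gen 15, Sunday typer «UNIFORM-IN-n»).
Finite-dimensional EXTERIOR ALGEBRA over a field ONLY: no variety, no cohomology theory, no sheaf, no Ext group, no semiregularity map;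
nothing here says that HC / HC_CM / HC_AV holds; no Literature fact is declared or used.  Custodian versions as in `WedgeHankelSiegelIdeal`
(1/3) and `WedgeHankelFrameChange`; FORMULA-N PART A §2.1–§2.2 (th-6: «the complex structure enters only through the frame»), PART B §N.8.
The dictionary (`v = Σ_j q_j Θ^j/j!` ↦ `w_m(q)`; reversal `q_j ↦ q_{m−j}` ↦ the inversion `Θ ↦ 1/Θ` of the node, `0 ↔ ∞`) is QUOTED, never asserted.

WHAT IS IN THE TREE / KEYED.  `WedgeHankelFrameChange` (gen 15 E5): the shear `x_a ↦ x_a + λ y_a` as an automorphism `Φs λ` with `Φs λ (w_m(q)) = w_m(exp(λΘ)·q)`;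
`WedgeHankelConfluent(Point)` (E3/E4): the confluent kernel laws at `0` and at `∞`, the latter proved by REPEATING the induction with `x` and `y` exchanged.
THIS FILE supplies the exchange itself, once and for all:
* §31 the SWAP of the generators `e_{x_a} ↔ e_{y_a}` (an involutive linear equivalence) and the induced automorphism **`Ψs := mapEquiv swap`**: `Ψs (x_a) = y_a`,
  `Ψs (y_a) = x_a`; **`Ψs_w`: `Ψs (w_m(q)) = w_m(rev_m q)`**, `(rev_m q)_j = q_{m−j}` — th-7's recursion builds the same class with the roles of `x_m`, `y_m`
  exchanged (uses gen 14's `w_eq_of_agree`: `w_m` reads `q_0..q_m` only).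
* §32 TRANSPORT (as in E5): `Kr(univ, Ψs f, k) = Ψs (Kr(univ, f, k))`, images likewise; **`Kr_w_rev`: `Kr(univ, w_n(rev_n q), k) = Ψs (Kr(univ, w_n(q), k))`**; the Siegel
  vectors go to their negatives, so **`map_Ψs_siegelIdeal`: `Ψs (SI_k) = SI_k`**; **`map_Ψs_plane`: `Ψs (plane(a,b)) = plane(b,a)`**, hence `Ψs (xRich(k,P)) = yRich(k,P)`.
* §33 **THE NODE AT `∞` FROM THE NODE AT `0`: `map_Ψs_Kr_w_of_order`: `Ψs (Kr(univ, w_n(q), k)) = SI_k ⊔ yRich(k,P)`** for `q` of order `P` at `0`, and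
  **`Kr_w_rev_of_order`**: the reversed class has kernel `SI_k ⊔ yRich(k,P)` (`k + P ≤ n`) — E4's law at `∞` re-derived structurally (E4's induction is independent;
  `w_rev_rev`: every class is the reversal of its reversal).
NOT typed here: the diagonal scalings `y_a ↦ μ y_a` (`Θ ↦ μΘ`, immediate by the same recipe) and the resulting `GL_2`-action on the pair `(x_a, y_a)` / Möbius action on
the nodes; several nodes; anything Ext-side.  Class side only.  Namespace `Summit.Ventures.HSemireg.Wedge.HankelFrameChange` (continued).
-/

open Module

namespace Summit.Ventures.HSemireg.Wedge.HankelFrameChange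

open Summit.Ventures.HSemireg.Wedge Summit.Ventures.HSemireg.Wedge.Kunneth Summit.Ventures.HSemireg.Wedge.Hankel
  Summit.Ventures.HSemireg.Wedge.BasisFree Summit.Ventures.HSemireg.Wedge.HankelSiegel Summit.Ventures.HSemireg.Wedge.HankelSiegelIdeal
  Summit.Ventures.HSemireg.Wedge.KunnethKernel Summit.Ventures.HSemireg.Wedge.HankelRankOne

variable (K : Type*) [Field K] {n : ℕ}

/-! ## §31. The swap of the generators and the induced automorphism -/

/-- the partner index: `x_a ↔ y_a` (`i ↦ i + n` for `i < n`, `i ↦ i − n` for `i ≥ n`). -/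
def partner (i : In n) : In n :=
  if h : n ≤ (i : ℕ) then ⟨i - n, by have := i.2; omega⟩ else ⟨i + n, by have := i.2; omega⟩

omit [Field K] in
/-- the partner map is an involution. -/
lemma partner_partner (i : In n) : partner (partner i) = i := by
  unfold partner
  by_cases h : n ≤ (i : ℕ)
  · rw [dif_pos h]
    have h' : ¬ n ≤ ((⟨i - n, by have := i.2; omega⟩ : In n) : ℕ) := by simp; have := i.2; omega
    rw [dif_neg h']; ext; simp; omega
  · rw [dif_neg h]
    have h' : n ≤ ((⟨i + n, by have := i.2; omega⟩ : In n) : ℕ) := by simp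
    rw [dif_pos h']; ext; simp

omit [Field K] in
/-- the partner of `x_a` is `y_a`. -/
lemma partner_castAdd (a : Fin n) : partner (Fin.castAdd n a) = Fin.natAdd n a := by
  unfold partner
  have h : ¬ n ≤ ((Fin.castAdd n a : In n) : ℕ) := by rw [Fin.val_castAdd]; have := a.2; omega
  rw [dif_neg h]; ext; simp [Nat.add_comm]

omit [Field K] in
/-- the partner of `y_a` is `x_a`. -/
lemma partner_natAdd (a : Fin n) : partner (Fin.natAdd n a) = Fin.castAdd n a := by
  unfold partner
  have h : n ≤ ((Fin.natAdd n a : In n) : ℕ) := by rw [Fin.val_natAdd]; omega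
  rw [dif_pos h]; ext; simp

/-- **THE SWAP** on coefficient vectors: `(swapLin v)(i) = v(partner i)`. -/
noncomputable def swapLin : (In n → K) →ₗ[K] (In n → K) where
  toFun v i := v (partner i)
  map_add' _ _ := rfl
  map_smul' _ _ := rfl

/-- the swap is an involution. -/
lemma swapLin_swapLin (v : In n → K) : swapLin K (swapLin K v) = v := by
  funext i; show v (partner (partner i)) = v i; rw [partner_partner]

/-- **the swap as a linear equivalence** (its own inverse). -/
noncomputable def swap : (In n → K) ≃ₗ[K] (In n → K) where
  toLinearMap := swapLin K
  invFun := swapLin K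
  left_inv v := swapLin_swapLin K v
  right_inv v := swapLin_swapLin K v

/-- the swap exchanges the basis vectors `e_{x_a}` and `e_{y_a}`. -/
lemma swap_b_castAdd (a : Fin n) : swap K (n := n) (b K (In n) (Fin.castAdd n a)) = b K (In n) (Fin.natAdd n a) := by
  funext i
  show b K (In n) (Fin.castAdd n a) (partner i) = _
  rw [b_apply', b_apply']
  by_cases h : i = Fin.natAdd n a
  · rw [if_pos h, if_pos (by rw [h, partner_natAdd])]
  · rw [if_neg h, if_neg (fun e => h (by rw [← partner_partner i, e, partner_castAdd]))]

/-- … and `e_{y_a} ↦ e_{x_a}`. -/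
lemma swap_b_natAdd (a : Fin n) : swap K (n := n) (b K (In n) (Fin.natAdd n a)) = b K (In n) (Fin.castAdd n a) := by
  funext i
  show b K (In n) (Fin.natAdd n a) (partner i) = _
  rw [b_apply', b_apply']
  by_cases h : i = Fin.castAdd n a
  · rw [if_pos h, if_pos (by rw [h, partner_castAdd])]
  · rw [if_neg h, if_neg (fun e => h (by rw [← partner_partner i, e, partner_natAdd]))]

/-- **THE SWAP AUTOMORPHISM `Ψs := mapEquiv swap`** of `⋀(K^{2n})`. -/
noncomputable def Ψs : HT K (In n) ≃ₐ[K] HT K (In n) := mapEquiv K (swap K (n := n))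

/-- `Ψs (ι v) = ι (swap v)`. -/
lemma Ψs_ι (v : In n → K) : Ψs K (ExteriorAlgebra.ι K v) = ExteriorAlgebra.ι K (swap K v) := by
  rw [Ψs, mapEquiv_apply, ExteriorAlgebra.map_apply_ι]; rfl

/-- **`Ψs (x_a) = y_a`.** -/
theorem Ψs_X (a : Fin n) : Ψs K (X K n a) = Y K n a := by
  rw [X_fin, Ψs_ι, swap_b_castAdd, ← Y_fin]

/-- **`Ψs (y_a) = x_a`.** -/
theorem Ψs_Y (a : Fin n) : Ψs K (Y K n a) = X K n a := by
  rw [Y_fin, Ψs_ι, swap_b_natAdd, ← X_fin]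

/-- `Ψs (X_c) = Y_c`, `ℕ`-indexed (both `0` beyond `n`). -/
lemma Ψs_X' (c : ℕ) : Ψs K (X K n c) = Y K n c := by
  by_cases hc : c < n
  · exact Ψs_X K ⟨c, hc⟩
  · rw [X, Y, dif_neg hc, dif_neg hc, map_zero]

/-- `Ψs (Y_c) = X_c`, `ℕ`-indexed. -/
lemma Ψs_Y' (c : ℕ) : Ψs K (Y K n c) = X K n c := by
  by_cases hc : c < n
  · exact Ψs_Y K ⟨c, hc⟩
  · rw [X, Y, dif_neg hc, dif_neg hc, map_zero]

/-- the reversal of a coefficient sequence at length `m`: `(rev_m q)_j = q_{m−j}` for `j ≤ m`, `0` beyond. -/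
def rev (m : ℕ) (q : ℕ → K) : ℕ → K := fun j => if j ≤ m then q (m - j) else 0

/-- the reversal on `[0, m]`. -/
lemma rev_apply_of_le {m j : ℕ} (h : j ≤ m) (q : ℕ → K) : rev K m q j = q (m - j) := if_pos h

/-- the reversal vanishes beyond `m`. -/
lemma rev_apply_of_lt {m j : ℕ} (h : m < j) (q : ℕ → K) : rev K m q j = 0 := if_neg (by omega)

/-- **`Ψs (w_m(q)) = w_m(rev_m q)` for every `m ≤ n` and every `q`** — th-7's recursion with `x_m` and `y_m` exchanged builds the reversed class. -/
theorem Ψs_w {m : ℕ} (hm : m ≤ n) (q : ℕ → K) : Ψs K (w K n m q) = w K n m (rev K m q) := by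
  induction m generalizing q with
  | zero => rw [w, w, map_smul, map_one, rev_apply_of_le K le_rfl]
  | succ m ih =>
    have hmn : m < n := by omega
    have hX : X K n m = X K n (⟨m, hmn⟩ : Fin n) := rfl
    have hY : Y K n m = Y K n (⟨m, hmn⟩ : Fin n) := rfl
    rw [w, w, map_add, map_mul, map_mul, ih (by omega), ih (by omega), hX, hY, Ψs_X, Ψs_Y]
    -- the two summands exchange: w_m(rev_m (σq)) ∧ y_m + w_m(rev_m q) ∧ x_m, and rev_m (σq) = rev_{m+1} q, rev_m q = σ (rev_{m+1} q) on [0, m]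
    have e1 : w K n m (rev K m (shift K q)) = w K n m (rev K (m + 1) q) :=
      w_eq_of_agree K m fun i hi => by
        rw [rev_apply_of_le K hi, rev_apply_of_le K (by omega), shift_apply]; congr 1; omega
    have e2 : w K n m (rev K m q) = w K n m (shift K (rev K (m + 1) q)) :=
      w_eq_of_agree K m fun i hi => by
        rw [shift_apply, rev_apply_of_le K hi, rev_apply_of_le K (by omega)]; congr 1; omega
    rw [e1, e2, add_comm]

/-! ## §32. Transport: kernels, images, the Siegel ideal, the planes -/

/-- `mapEquiv g` maps `⋀^k` onto `⋀^k` (gen 6), membership form. -/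
lemma mapEquiv_mem_exteriorPower (g : (In n → K) ≃ₗ[K] (In n → K)) {k : ℕ} {θ : HT K (In n)} (hθ : θ ∈ ⋀[K]^k (In n → K)) :
    mapEquiv K g θ ∈ ⋀[K]^k (In n → K) := by
  rw [← map_exteriorPower K g k]; exact ⟨θ, hθ, rfl⟩

/-- **KERNELS ARE TRANSPORTED by every automorphism induced from the generators: `Kr(univ, mapEquiv g f, k) = mapEquiv g (Kr(univ, f, k))`.** -/
theorem Kr_mapEquiv (g : (In n → K) ≃ₗ[K] (In n → K)) (f : HT K (In n)) (k : ℕ) :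
    Kr K Finset.univ (mapEquiv K g f) k = (Kr K Finset.univ f k).map (mapEquiv K g).toLinearMap := by
  ext θ
  rw [mem_Kr, Submodule.mem_map, KunnethKernel.Hom_univ_eq_exteriorPower]
  constructor
  · rintro ⟨hθ, h0⟩
    have hθ' : θ ∈ (⋀[K]^k (In n → K)).map (mapEquiv K g).toLinearMap := by rwa [map_exteriorPower]
    obtain ⟨θ', hθ', rfl⟩ := hθ'
    refine ⟨θ', mem_Kr.mpr ⟨by rwa [KunnethKernel.Hom_univ_eq_exteriorPower], ?_⟩, rfl⟩
    apply (mapEquiv K g).injective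
    rw [map_mul, map_zero]; exact h0
  · rintro ⟨θ', hθ', rfl⟩
    rw [mem_Kr, KunnethKernel.Hom_univ_eq_exteriorPower] at hθ'
    refine ⟨mapEquiv_mem_exteriorPower K g hθ'.1, ?_⟩
    rw [AlgEquiv.toLinearMap_apply, ← map_mul, hθ'.2, map_zero]

/-- **IMAGES ARE TRANSPORTED: `V(univ, mapEquiv g f, k) = mapEquiv g (V(univ, f, k))`.** -/
theorem V_mapEquiv (g : (In n → K) ≃ₗ[K] (In n → K)) (f : HT K (In n)) (k : ℕ) :
    V K (In n) Finset.univ (mapEquiv K g f) k = (V K (In n) Finset.univ f k).map (mapEquiv K g).toLinearMap := by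
  have hc : (mapEquiv K g).toLinearMap ∘ₗ LinearMap.mulRight K f =
      LinearMap.mulRight K (mapEquiv K g f) ∘ₗ (mapEquiv K g).toLinearMap := by
    ext θ; simp [map_mul]
  rw [V_eq_map, V_eq_map, ← Submodule.map_comp, hc, Submodule.map_comp, KunnethKernel.Hom_univ_eq_exteriorPower, map_exteriorPower]

/-- **REVERSING THE COEFFICIENTS MOVES THE KERNELS BY THE SWAP: `Kr(univ, w_n(rev_n q), k) = Ψs (Kr(univ, w_n(q), k))`.** -/
theorem Kr_w_rev (q : ℕ → K) (k : ℕ) :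
    Kr K Finset.univ (w K n n (rev K n q)) k = (Kr K Finset.univ (w K n n q) k).map (Ψs K (n := n)).toLinearMap := by
  rw [← Ψs_w K le_rfl]; exact Kr_mapEquiv K _ _ k

/-- … and the images: `V(univ, w_n(rev_n q), k) = Ψs (V(univ, w_n(q), k))`. -/
theorem V_w_rev (q : ℕ → K) (k : ℕ) :
    V K (In n) Finset.univ (w K n n (rev K n q)) k = (V K (In n) Finset.univ (w K n n q) k).map (Ψs K (n := n)).toLinearMap := by
  rw [← Ψs_w K le_rfl]; exact V_mapEquiv K _ _ k

/-- **THE SIEGEL VECTORS GO TO THEIR NEGATIVES: `Ψs (s_{ab}) = −s_{ab}`.** -/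
theorem Ψs_sv (a c : ℕ) : Ψs K (sv K (n := n) a c) = -sv K a c := by
  rw [sv]
  by_cases hac : a = c
  · subst hac
    rw [if_pos rfl, add_zero, map_mul, Ψs_X', Ψs_Y', anticomm_of_gen (Y_gen K a) (X_gen K a)]
  · rw [if_neg hac, map_add, map_mul, map_mul, Ψs_X', Ψs_Y', Ψs_X', Ψs_Y', anticomm_of_gen (Y_gen K a) (X_gen K c),
      anticomm_of_gen (Y_gen K c) (X_gen K a), neg_add]
    abel

/-- **THE SIEGEL IDEAL IS SWAP-INVARIANT: `Ψs (SI_k) = SI_k`.** -/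
theorem map_Ψs_siegelIdeal (k : ℕ) : (siegelIdeal K n k).map (Ψs K (n := n)).toLinearMap = siegelIdeal K n k := by
  have hle : (siegelIdeal K n k).map (Ψs K (n := n)).toLinearMap ≤ siegelIdeal K n k := by
    rw [siegelIdeal, Submodule.map_span, Submodule.span_le]
    rintro _ ⟨_, ⟨p, rfl⟩, rfl⟩
    obtain ⟨⟨t, ht⟩, s⟩ := p
    subst ht
    rw [SetLike.mem_coe, AlgEquiv.toLinearMap_apply, igen, map_mul, sgen, Ψs_sv, ← sgen, mul_neg]
    have hB : B K (In n) t ∈ ⋀[K]^t.card (In n → K) := by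
      rw [exteriorPower_eq_Hom_univ]; exact B_mem_Hom K (Finset.subset_univ t) rfl
    exact Submodule.neg_mem _ (mul_sgen_mem_siegelIdeal K (mapEquiv_mem_exteriorPower K _ hB) s)
  exact Submodule.eq_of_le_of_finrank_eq hle ((Ψs K (n := n)).toLinearEquiv.finrank_map_eq _)

/-- `Ψs (x_P) ∈ plane(0, |P|)`: a pure-`x` monomial goes to a multiple of the pure-`y` monomial on the same letters. -/
lemma Ψs_B_xs_mem (P : Finset (Fin n)) : Ψs K (B K (In n) (xs P)) ∈ plane K n 0 P.card := by
  induction P using Finset.induction_on with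
  | empty =>
    rw [xs, Finset.map_empty, B_empty, map_one, Finset.card_empty]
    have : (1 : HT K (In n)) = pmon K ((⟨∅, rfl⟩, ⟨∅, rfl⟩) : PIdx n 0 0) := by
      rw [pmon]; simp only [xs, ys, Finset.map_empty, Finset.union_empty]; exact (B_empty K).symm
    rw [this]; exact Submodule.subset_span ⟨_, rfl⟩
  | insert a P ha ih =>
    obtain ⟨c, hc, h⟩ := B_mul_gx K (I := In n) (i := Fin.castAdd n a) (t := xs P) (by rw [castAdd_mem_xs]; exact ha)
    have e : B K (In n) (xs (insert a P)) = c⁻¹ • (B K (In n) (xs P) * gx K (Fin.castAdd n a)) := by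
      rw [xs_insert, h, smul_smul, inv_mul_cancel₀ hc, one_smul]
    rw [e, map_smul, map_mul, ← X_eq_gx, Ψs_X, Finset.card_insert_of_notMem ha]
    exact Submodule.smul_mem _ _ (mul_Y_mem_plane K ih a)

/-- `Ψs (y_Q) ∈ plane(|Q|, 0)`. -/
lemma Ψs_B_ys_mem (Q : Finset (Fin n)) : Ψs K (B K (In n) (ys Q)) ∈ plane K n Q.card 0 := by
  induction Q using Finset.induction_on with
  | empty =>
    rw [ys, Finset.map_empty, B_empty, map_one, Finset.card_empty]
    have : (1 : HT K (In n)) = pmon K ((⟨∅, rfl⟩, ⟨∅, rfl⟩) : PIdx n 0 0) := by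
      rw [pmon]; simp only [xs, ys, Finset.map_empty, Finset.union_empty]; exact (B_empty K).symm
    rw [this]; exact Submodule.subset_span ⟨_, rfl⟩
  | insert a Q ha ih =>
    obtain ⟨c, hc, h⟩ := B_mul_gx K (I := In n) (i := Fin.natAdd n a) (t := ys Q) (by rw [natAdd_mem_ys]; exact ha)
    have e : B K (In n) (ys (insert a Q)) = c⁻¹ • (B K (In n) (ys Q) * gx K (Fin.natAdd n a)) := by
      rw [ys_insert, h, smul_smul, inv_mul_cancel₀ hc, one_smul]
    rw [e, map_smul, map_mul, ← Y_eq_gx, Ψs_Y, Finset.card_insert_of_notMem ha]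
    exact Submodule.smul_mem _ _ (mul_X_mem_plane K ih a)

/-- `Ψs` of a plane monomial of type `(a,b)` lies in `plane(b,a)`. -/
lemma Ψs_pmon_mem {a b : ℕ} (i : PIdx n a b) : Ψs K (pmon K i) ∈ plane K n b a := by
  obtain ⟨c, -, h⟩ := pmon_eq_smul_mul K i
  rw [h, map_smul, map_mul]
  have := mul_mem_plane K (Ψs_B_xs_mem K i.1.1) (Ψs_B_ys_mem K i.2.1)
  rw [i.1.2, i.2.2, zero_add, add_zero] at this
  exact Submodule.smul_mem _ _ this

/-- **THE SWAP EXCHANGES THE DOLBEAULT BLOCKS: `Ψs (plane(a,b)) = plane(b,a)`** (dictionary: `H^b(⋀^a T) ↔ H^a(⋀^b T)`). -/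
theorem map_Ψs_plane (a b : ℕ) : (plane K n a b).map (Ψs K (n := n)).toLinearMap = plane K n b a := by
  have hle : (plane K n a b).map (Ψs K (n := n)).toLinearMap ≤ plane K n b a := by
    rw [plane, Submodule.map_span, Submodule.span_le]
    rintro _ ⟨_, ⟨i, rfl⟩, rfl⟩
    exact Ψs_pmon_mem K i
  refine Submodule.eq_of_le_of_finrank_eq hle ?_
  rw [(Ψs K (n := n)).toLinearEquiv.finrank_map_eq, finrank_plane, finrank_plane, mul_comm]

/-- hence **`Ψs (xRich(k, P)) = yRich(k, P)`**: «more than `P` x-letters» ↔ «more than `P` y-letters». -/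
theorem map_Ψs_xRich (k P : ℕ) : (xRich K n k P).map (Ψs K (n := n)).toLinearMap = yRich K n k P := by
  rw [xRich, yRich, Submodule.map_iSup]
  refine iSup_congr fun a => ?_
  rw [Submodule.map_iSup]
  refine iSup_congr fun _ => ?_
  rw [map_Ψs_plane]

/-! ## §33. The node at `∞` from the node at `0` -/

/-- a sequence agrees with its double reversal on `[0, n]`, so their classes coincide. -/
lemma w_rev_rev (q : ℕ → K) : w K n n (rev K n (rev K n q)) = w K n n q :=
  w_eq_of_agree K n fun i hi => by
    rw [rev_apply_of_le K hi, rev_apply_of_le K (by omega)]; congr 1; omega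

/-- **THE SWAP CARRIES THE NODE-`0` KERNEL TO THE NODE-`∞` KERNEL: `Ψs (Kr(univ, w_n(q), k)) = SI_k ⊔ yRich(k, P)`** for `q` supported on `[0, P]`,
`q_P ≠ 0`, `k + P ≤ n` (E3's law transported; E4's `Kr_w_eq_of_order_top` is the same statement for the reversed sequence, proved there by induction). -/
theorem map_Ψs_Kr_w_of_order {k P : ℕ} (hkP : k + P ≤ n) {q : ℕ → K} (hq : ∀ j, P < j → q j = 0) (hqP : q P ≠ 0) :
    (Kr K Finset.univ (w K n n q) k).map (Ψs K (n := n)).toLinearMap = siegelIdeal K n k ⊔ yRich K n k P := by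
  rw [Kr_w_eq_of_order K hkP hq hqP, Submodule.map_sup, map_Ψs_siegelIdeal, map_Ψs_xRich]

/-- **THE REVERSED CLASS (node `∞`): `Kr(univ, w_n(rev_n q), k) = SI_k ⊔ yRich(k, P)`** for `q` supported on `[0, P]`, `q_P ≠ 0`, `k + P ≤ n` — a second,
structural route to E4's confluent kernel law at `∞` (every `q′` supported on `[n − P, n]` is `rev_n q` on `[0, n]` for such a `q`, `w_rev_rev`). -/
theorem Kr_w_rev_of_order {k P : ℕ} (hkP : k + P ≤ n) {q : ℕ → K} (hq : ∀ j, P < j → q j = 0) (hqP : q P ≠ 0) :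
    Kr K Finset.univ (w K n n (rev K n q)) k = siegelIdeal K n k ⊔ yRich K n k P := by
  rw [Kr_w_rev, map_Ψs_Kr_w_of_order K hkP hq hqP]

end Summit.Ventures.HSemireg.Wedge.HankelFrameChange
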